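import Summits.HodgeConjecture.HodgeConjecture.Cruxes.H413.Lines.R90_S3_EndoFibreDefsC
import Summits.HodgeConjecture.HodgeConjecture.Cruxes.H413.Lines.R90_S4_HPacketsU2B
import Summits.HodgeConjecture.HodgeConjecture.Cruxes.H413.Lines.R90_S3_EndoExpansionByTypeD
import Summits.HodgeConjecture.HodgeConjecture.Theorems.R90S3EndoExpansionSplit          -- ★ p861924 (R-ii)
import Summits.HodgeConjecture.HodgeConjecture.Cruxes.H413.Lines.R90_S3_PrintInputsE       -- Lines E ED. 2 (socket 6)
import Literature.NumberTheory.Rogawski1990.FinExplicitTransferFactorConjRight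
import Literature.NumberTheory.Automorphic.OrbitalMeasureCanonical
import Literature.NumberTheory.Automorphic.QuadraticHeckeCharacterCM
import HarnessLib

/-!
# R90 · S3 · FILE A — `R90_S3_EndoCharIdentityA`: kit-free ENDOSCOPIC CHARACTER IDENTITIES at a finite place (Rogawski 1990 §13.1 Thm. 13.1.1 (2))

R90-TF SLAB (brief v2 1f40d54518340a35), section S3 (Ch. 12 non-archimedean local transfer + character identities), dealer R90-C12-plan (g0),
LEAD #3 L8 ∕ #5 (3) ∕ #8 seam of record: **S4 (E-S4) owns the DEFINED `rogawskiLocalKit` and the classification `CLASSIFIES`; S3 is kit-free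
harmonic analysis** — it EXPORTS the predicates∕functions below, over which S4 sets `pair := endoCoeff …`, `xiH := endoFibre …` so that the
consumer row (KT2″) ★ `SpectralPacketH.CharIdentityψS` unfolds by `rfl`, and ONE socket (A1).

* The fibre objects `IsStableFinsetH`, `IsEndoExpansion`, `endoCoeff`, `endoFibre` and their sorry-free read-backs (`endoCoeff_spec`,
  `isEndoExpansion_unique`, …) live in the ONE HOME `R90_S3_EndoFibreDefsC` (LEAD #10 (A)), imported here; the H-side packet predicate
  `R90.S4.IsRogPacketH` is S4-B's (`R90_S4_HPacketsU2B`, ★-only imports, L9 defs-down), imported here BY NAME — no junction copy.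
* THE SOCKET A1 `stub_R90_S3_endoExpansion_exists` — Thm. 13.1.1 (2) (+ 13.1.3 (c)(d), 13.1.4 by linearity) AT THE RECORD LOCAL DATA (RULING S3-R1 =
  AUDIT S3#1 F-a: Haar measures, CANONICAL orbital families, `Δ‴_v = finExplicitCollection …`, non-split `v`; a free `Δ` is scale-refutable).
PAID ∕ OWNED ELSEWHERE (index edges for `R90_TF_Index.lean`, NOT re-typed here — C4): the 1-dim case `⟨ξ,·⟩ ≡ 1` on `Π(ξ_v) = {πⁿ, πˢ}` (Prop. 13.1.4)
= CLOSED `F0U3LettersRung1.stub_QCMTS` (∀ H); the Steinberg case `Tr St_H-partner(f^H) = ε_v·(Tr π²(f) − Tr πˢ(f))` (Prop. 13.1.3 (d), signed at Δ‴)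
= the L4 leaf `F0U3LettersRung1.stub_StCharTS`.  Read through `isEndoExpansion_unique` they give `endoCoeff {ξ_v} = single πⁿ 1 + single πˢ 1` and
`endoCoeff {St-partner} = ε_v • (single π² 1 − single πˢ 1)`.
WAITS ON E-S4 (docstring only, L8 (iii)): the values `⟨ρ,π⟩ ∈ {±1}`, `Card (endoFibre ρ) = 2·Card ρ` for `ρ ∈ Π²(H_v)`, disjointness of the fibres —
these are clauses of S4's `CLASSIFIES`, not S3 sockets.
ED. 2 (typist R90-C12-typ2 (g2); dealer 16:12:04Z (1) «D WRITE — GO», architect SECTION-MAP ED. 2 row 102): A1's STATEMENT is BYTE-FROZEN (ED. 1 :54–:94); its body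
`sorry` is REPLACED by the junction BY NAME to FILE D `R90_S3_EndoExpansionByTypeD` (imported; D imports C + S4-B + ★ only, never A — L9): `stub_R90_S3_endoExpansion_exists … :=
endoExpansion_exists_of … (stub_R90_S3_endoExpansion_oneDim …) (stub_…_steinberg …) (stub_…_indPS …) (stub_…_ldsH …) (stub_…_rest …) ρ hρ` — D's PROVED head over
its five TYPE-SOCKETS (T1 oneDim · T2 steinberg · T3 indPS · T4 ldsH · T5 rest; exhaustion `HPacket_type_cases` proved by logic).  This file now holds NO `sorry`:
the open leaves below A1 are D's five type-sockets (T1–T4 paid at D ED. 2 by the ★ hands `R90S3EndoExpansionOneDim` p861615 ∕ `…SteinbergOfStCharTS` p861644 ∕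
`…IndPS` p861751 ∕ `…LdsH` + FILE E's print sockets, S3-R4; T5 «rest» = Thm. 13.1.1 (2) proper, GLOBAL road §13.8, hand p04).  PLUS ONE NEW SOCKET (RULING S3-R5″ (i)):
`stub_R90_S3_endoExpansion_exists_split` — A1's bytes with the single swap `hv` ↦ `hs : ∃ w, c • w.1 ≠ w.1` (a place SPLIT in `L`; payer p06 (R-ii)
`Theorems/R90S3EndoExpansionSplit.lean`); file B ED. 2's `kt2Clause_of_isEndoExpansion` (every finite `v`) is instantiated by A1 at a non-split `v` and by this
socket at a split `v`, in the consumer (B never imports A).  ED. 2 ONE-WRITE (dealer R90-C12-plan (g0) 21:30:35Z (W-A); audit1 pre-box probe 7f0424ec7495c385 farm rc 0 · sorries 0): the split socket is PAID at this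
edition too — body := ★ `endoExpansion_exists_split_of_stable_of_vanDijk` (p861924, hand p06 (R-ii)) over S4-B's `stub_R90_S4_H_stable` (δ-unfolds to `hS`) and FILE E's
print socket 6 `stub_R90_S3_print_4131b_vanDijkSplit` (E ED. 2 109bad63190d, BUILT BW186); this file now carries NO `sorry` token — the open leaves are E's six PRINT
sockets and S4-B's named stubs.
HONEST LABEL: this file proves nothing printed — it types 2 sockets (A1 paid by name from FILE D; the split socket paid by name from ★ (R-ii) + S4-B + FILE E, both from ED. 2) and proves book-keeping; HC_CM is proved only modulo the 7 printed
citations (2 remaining named inputs: hLiu418 = stmt-HodgeConjecture-24832, h413 = stmt-HodgeConjecture-24833) until rung 0 closes; REL ≠ ★ ≠ BUILT.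
-/

set_option linter.dupNamespace false

namespace Summit.HodgeConjecture.HodgeConjecture.R90.S3

open MeasureTheory IsDedekindDomain NumberField
open Literature.NumberTheory Literature.NumberTheory.Automorphic Literature.NumberTheory.Automorphic.UnitaryGroup
open Literature.NumberTheory.Rogawski1990 Literature.NumberTheory.GaloisRepresentations
open scoped Matrix

variable (L : Type) [Field L] [NumberField L] [IsCMField L] (H' : Matrix (Fin 3) (Fin 3) L)
  (v : HeightOneSpectrum (𝓞 ↥(maximalRealSubfield L)))

/-! ## THE SOCKET A1 (statement ED. 1, byte-frozen; ED. 2: body = junction to FILE D by name) -/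

/-- **SOCKET `stub_R90_S3_endoExpansion_exists`** [Thm. 13.1.1 (2) + Props. 13.1.3 (c)(d), 13.1.4 + linearity, pp. 198–199; transfer factor
of record `Δ‴_v` §4.9 p. 55]: at a NON-SPLIT finite place `v`, for the RECORD local data — Haar measures, CANONICAL orbital-measure families
(byte = ★ `TupleKitLawsK2` :176–177 ∕ `stub_StCharTS`), the explicit transfer factor `Δ‴_v = finExplicitCollection L H′ μ … v` of the unitary
Hecke character `μ` restricting to `ω_{E/F}` — and local `Δ‴_v`-transfer existing for smooth test functions (BY NAME, fed by the consumer's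
`TransferExistence`, in the tree ★ `isLocalDeltaTransferExists_finExplicit_of_isCanonical`), every L-PACKET `ρ` of `H_v` IN ROGAWSKI'S SENSE
(S4-B's DEFINED `R90.S4.IsRogPacketH L v ρ`: `ρ = O ⊠ χ₁`, `O` a similitude-conjugation orbit of an admissible class of `U(Φ₂)_v`, §11.1 p. 161,
§12.1 p. 171 — print-tight key, AUDIT S3#2 n1 ∕ RULING S3-R2; the harmonic-analysis reading `IsStableFinsetH` of file C is then S4-B's optional
`stub_R90_S4_H_stable`, OFF the payment path) has an endoscopic expansion with INTEGER coefficients: Π²-packets by Thm. 13.1.1 (2), one-dimensional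
`ρ` by Prop. 13.1.4, `St_H(ξ)`-type and the exceptional packets by Prop. 13.1.3 (c)(d) (p. 199 ¶3), irreducible principal series by §12.7.
(AUDIT S3#1 F-a: NOT stated over a free `Δ` — scale-refutable; the coefficients are print's `⟨ρ,π⟩ = ±1` times the form sign carried by `Δ‴`.)
[cite: Rogawski1990, §13.1 Thm. 13.1.1 (2) p. 198, Props. 13.1.3–13.1.4 p. 199; §4.9 pp. 54–55; §11.1 p. 161; §12.1 p. 171; §12.7 Lemma 12.7.3 p. 195] -/
theorem stub_R90_S3_endoExpansion_exists
    (hH' : (H'.map (cmConjRingHom L))ᵀ = H') (hH'd : IsUnit H'.det)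
    (μ : HeckeCharacter L) (hμu : μ.IsUnitary)
    (hμω : ∀ x : Literature.NumberTheory.GaloisRepresentations.ideleGroup ↥(maximalRealSubfield L),
      μ (AdeleRing.ideleBaseChange (↥(maximalRealSubfield L)) L x) = quadraticHeckeCharCM L x)
    (hv : ∀ w : UnitaryGroup.PlacesOver L v, IsCMField.complexConj L • w.1 = w.1)
    [MeasurableSpace ((UnitaryGroup.cmDatum L 3 H').Local v)] [BorelSpace ((UnitaryGroup.cmDatum L 3 H').Local v)]
    [MeasurableSpace ((UnitaryGroup.cmDatum L 2 (Matrix.of fun i j : Fin 2 => if i.val + j.val + 1 = 2 then (1 : L) else 0)).Local v ×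
      (UnitaryGroup.cmDatum L 1 (Matrix.of fun i j : Fin 1 => if i.val + j.val + 1 = 1 then (1 : L) else 0)).Local v)]
    [BorelSpace ((UnitaryGroup.cmDatum L 2 (Matrix.of fun i j : Fin 2 => if i.val + j.val + 1 = 2 then (1 : L) else 0)).Local v ×
      (UnitaryGroup.cmDatum L 1 (Matrix.of fun i j : Fin 1 => if i.val + j.val + 1 = 1 then (1 : L) else 0)).Local v)]
    [∀ a : ((UnitaryGroup.cmDatum L 2 (Matrix.of fun i j : Fin 2 => if i.val + j.val + 1 = 2 then (1 : L) else 0)).Local v ×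
      (UnitaryGroup.cmDatum L 1 (Matrix.of fun i j : Fin 1 => if i.val + j.val + 1 = 1 then (1 : L) else 0)).Local v),
      MeasurableSpace (((UnitaryGroup.cmDatum L 2 (Matrix.of fun i j : Fin 2 => if i.val + j.val + 1 = 2 then (1 : L) else 0)).Local v ×
      (UnitaryGroup.cmDatum L 1 (Matrix.of fun i j : Fin 1 => if i.val + j.val + 1 = 1 then (1 : L) else 0)).Local v) ⧸
        Subgroup.centralizer ({a} : Set ((UnitaryGroup.cmDatum L 2 (Matrix.of fun i j : Fin 2 => if i.val + j.val + 1 = 2 then (1 : L) else 0)).Local v ×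
      (UnitaryGroup.cmDatum L 1 (Matrix.of fun i j : Fin 1 => if i.val + j.val + 1 = 1 then (1 : L) else 0)).Local v)))]
    [∀ a : ((UnitaryGroup.cmDatum L 2 (Matrix.of fun i j : Fin 2 => if i.val + j.val + 1 = 2 then (1 : L) else 0)).Local v ×
      (UnitaryGroup.cmDatum L 1 (Matrix.of fun i j : Fin 1 => if i.val + j.val + 1 = 1 then (1 : L) else 0)).Local v),
      BorelSpace (((UnitaryGroup.cmDatum L 2 (Matrix.of fun i j : Fin 2 => if i.val + j.val + 1 = 2 then (1 : L) else 0)).Local v ×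
      (UnitaryGroup.cmDatum L 1 (Matrix.of fun i j : Fin 1 => if i.val + j.val + 1 = 1 then (1 : L) else 0)).Local v) ⧸
        Subgroup.centralizer ({a} : Set ((UnitaryGroup.cmDatum L 2 (Matrix.of fun i j : Fin 2 => if i.val + j.val + 1 = 2 then (1 : L) else 0)).Local v ×
      (UnitaryGroup.cmDatum L 1 (Matrix.of fun i j : Fin 1 => if i.val + j.val + 1 = 1 then (1 : L) else 0)).Local v)))]
    [∀ γ : ((UnitaryGroup.cmDatum L 3 H').Local v), MeasurableSpace (((UnitaryGroup.cmDatum L 3 H').Local v) ⧸ Subgroup.centralizer ({γ} : Set ((UnitaryGroup.cmDatum L 3 H').Local v)))]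
    [∀ γ : ((UnitaryGroup.cmDatum L 3 H').Local v), BorelSpace (((UnitaryGroup.cmDatum L 3 H').Local v) ⧸ Subgroup.centralizer ({γ} : Set ((UnitaryGroup.cmDatum L 3 H').Local v)))]
    (νG : Measure ((UnitaryGroup.cmDatum L 3 H').Local v)) [νG.IsHaarMeasure] [νG.IsMulRightInvariant]
    (νH : Measure ((UnitaryGroup.cmDatum L 2 (Matrix.of fun i j : Fin 2 => if i.val + j.val + 1 = 2 then (1 : L) else 0)).Local v ×
      (UnitaryGroup.cmDatum L 1 (Matrix.of fun i j : Fin 1 => if i.val + j.val + 1 = 1 then (1 : L) else 0)).Local v))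
    [νH.IsHaarMeasure] [νH.IsMulRightInvariant]
    (mH : OrbitalMeasureFamily ((UnitaryGroup.cmDatum L 2 (Matrix.of fun i j : Fin 2 => if i.val + j.val + 1 = 2 then (1 : L) else 0)).Local v ×
      (UnitaryGroup.cmDatum L 1 (Matrix.of fun i j : Fin 1 => if i.val + j.val + 1 = 1 then (1 : L) else 0)).Local v))
    (mG : OrbitalMeasureFamily ((UnitaryGroup.cmDatum L 3 H').Local v))
    (hm : mH.IsCanonical (IsLocalGRegular L v) νH ∧
      mG.IsCanonical (fun γ => IsRegularElt (γ.val : GL (Fin 3) (UnitaryGroup.LocalRing L v))) νG)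
    (hT : IsLocalDeltaTransferExists L H' v (finExplicitCollection L H' μ (finExplicitDelta_conj_left_all L H' μ) (finExplicitDelta_conj_right_all L H' μ) v) mH mG
      IsLocSmooth IsLocSmooth)
    (ρ : Finset (IrrClass ((UnitaryGroup.cmDatum L 2 (Matrix.of fun i j : Fin 2 => if i.val + j.val + 1 = 2 then (1 : L) else 0)).Local v ×
      (UnitaryGroup.cmDatum L 1 (Matrix.of fun i j : Fin 1 => if i.val + j.val + 1 = 1 then (1 : L) else 0)).Local v)))
    (hρ : Summit.HodgeConjecture.HodgeConjecture.R90.S4.IsRogPacketH L v ρ) :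
    ∃ c : IrrClass ((UnitaryGroup.cmDatum L 3 H').Local v) →₀ ℤ,
      IsEndoExpansion L H' v νG νH (finExplicitCollection L H' μ (finExplicitDelta_conj_left_all L H' μ) (finExplicitDelta_conj_right_all L H' μ) v) mH mG ρ c :=
  -- ED. 2: PAID BY NAME from FILE D's proved head over its five type-sockets (statement above byte-frozen; `sorry` moved DOWN to D's T1–T5)
  endoExpansion_exists_of L H' v hH' hH'd μ hμu hμω hv νG νH mH mG hm hT
    (stub_R90_S3_endoExpansion_oneDim L H' v hH' hH'd μ hμu hμω hv νG νH mH mG hm hT)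
    (stub_R90_S3_endoExpansion_steinberg L H' v hH' hH'd μ hμu hμω hv νG νH mH mG hm hT)
    (stub_R90_S3_endoExpansion_indPS L H' v hH' hH'd μ hμu hμω hv νG νH mH mG hm hT)
    (stub_R90_S3_endoExpansion_ldsH L H' v hH' hH'd μ hμu hμω hv νG νH mH mG hm hT)
    (stub_R90_S3_endoExpansion_rest L H' v hH' hH'd μ hμu hμω hv νG νH mH mG hm hT)
    ρ hρ

/-! ## THE SPLIT-PLACE SOCKET (ED. 2; RULING S3-R5″ (i), AUDIT S3#12 pinning rider, census K2E3-p36 (b)) -/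

/-- **SOCKET `stub_R90_S3_endoExpansion_exists_split`** — A1 AT A PLACE `v` OF `L⁺` SPLIT IN `L` [§4.13 «the case of split primes» Lemma 4.13.1 (a)(b) p. 64:
`G_v ≅ GL₃(E_w)`, `H_v ≅ GL₂(E_w) × GL₁(E_w)` the Levi factor of `P` of type (2,1), `f^H(h) = μ_w(det₀ h) δ_P(h)^{1/2} ∫_{N_P} f^K(hn) dn` satisfies (a)
`Δ_{G/H}(γ)Φ^κ(γ,f) = Φ^st(γ,f^H)` and (b) `Tr(i_G(ρ′)(f)) = Tr(ρ(f^H))`, `ρ′ = ρ ⊗ μ_w∘det₀` — «no difference between ordinary, stable and κ-orbital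
integrals»; §4.9 p. 55 (`Δ = τ·D`, `κ_v ≡ +1` at a split place, §14.6 p. 242); Thm. 13.1.1 (2) p. 198 read at a split place]: A1's statement BYTE FOR BYTE
(binders :55–:92, conclusion :93–:94 of ED. 1)
with the SINGLE swap of the non-split guard `hv` for the split guard `hs : ∃ w : PlacesOver L v, c • w.1 ≠ w.1` — statement-sound because the record factor
★ `finExplicitCollection L H′ μ … v` at a split `v` IS print's `τ·D` (★ `finKappaAt_of_not_subsingleton`: `κ_v := 1` on the projector support; census (b)),
the measures∕families∕`hT`∕`IsRogPacketH` key are place-free.  Every Rogawski `H_v`-packet `ρ` then has an endoscopic expansion with INTEGER coefficients at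
the RECORD split data (the induced expansion `c = Σ_{σ∈ρ} Σ_{π ∈ JH(i_G(σ′))} mult · [π]`, Lemma 4.13.1 (b) + van Dijk's formula for `tr i_G`).  PAID (ED. 2) BY NAME: ★ p861924
`endoExpansion_exists_split_of_stable_of_vanDijk … hs … ρ hS hVD` with `hS :=` S4-B's `stub_R90_S4_H_stable L v νH mH hm.1 ρ hρ` and `hVD :=` FILE E's
`stub_R90_S3_print_4131b_vanDijkSplit … ρ hρ` (Lemma 4.13.1 (b) + finite length, print socket 6).  PAYER (hand p06
(R-ii), K2E3-p36): `Theorems/R90S3EndoExpansionSplit.lean` (constant term at `GL₃(L_w)`, ★ `VanDijkTraceParabolicIndGL*`, over S4-B's `stub_R90_S4_H_stable` read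
at a split `v` for ARBITRARY matched pairs); the LEAD's J-S3-split word may relabel this socket `aside` (consumer-side guard) — nothing else changes.  NOT over a
free `Δ` (AUDIT S3#1 F-a), NO kit, NO `ψ`. [cite: Rogawski1990, §4.13 Lemma 4.13.1 (a)(b) p. 64; §4.9 p. 55; §13.1 Thm. 13.1.1 (2) p. 198; §14.6 p. 242] [cite: vanDijk1972, Thm. 1] -/
theorem stub_R90_S3_endoExpansion_exists_split
    (hH' : (H'.map (cmConjRingHom L))ᵀ = H') (hH'd : IsUnit H'.det)
    (μ : HeckeCharacter L) (hμu : μ.IsUnitary)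
    (hμω : ∀ x : Literature.NumberTheory.GaloisRepresentations.ideleGroup ↥(maximalRealSubfield L),
      μ (AdeleRing.ideleBaseChange (↥(maximalRealSubfield L)) L x) = quadraticHeckeCharCM L x)
    (hs : ∃ w : UnitaryGroup.PlacesOver L v, IsCMField.complexConj L • w.1 ≠ w.1)
    [MeasurableSpace ((UnitaryGroup.cmDatum L 3 H').Local v)] [BorelSpace ((UnitaryGroup.cmDatum L 3 H').Local v)]
    [MeasurableSpace ((UnitaryGroup.cmDatum L 2 (Matrix.of fun i j : Fin 2 => if i.val + j.val + 1 = 2 then (1 : L) else 0)).Local v ×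
      (UnitaryGroup.cmDatum L 1 (Matrix.of fun i j : Fin 1 => if i.val + j.val + 1 = 1 then (1 : L) else 0)).Local v)]
    [BorelSpace ((UnitaryGroup.cmDatum L 2 (Matrix.of fun i j : Fin 2 => if i.val + j.val + 1 = 2 then (1 : L) else 0)).Local v ×
      (UnitaryGroup.cmDatum L 1 (Matrix.of fun i j : Fin 1 => if i.val + j.val + 1 = 1 then (1 : L) else 0)).Local v)]
    [∀ a : ((UnitaryGroup.cmDatum L 2 (Matrix.of fun i j : Fin 2 => if i.val + j.val + 1 = 2 then (1 : L) else 0)).Local v ×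
      (UnitaryGroup.cmDatum L 1 (Matrix.of fun i j : Fin 1 => if i.val + j.val + 1 = 1 then (1 : L) else 0)).Local v),
      MeasurableSpace (((UnitaryGroup.cmDatum L 2 (Matrix.of fun i j : Fin 2 => if i.val + j.val + 1 = 2 then (1 : L) else 0)).Local v ×
      (UnitaryGroup.cmDatum L 1 (Matrix.of fun i j : Fin 1 => if i.val + j.val + 1 = 1 then (1 : L) else 0)).Local v) ⧸
        Subgroup.centralizer ({a} : Set ((UnitaryGroup.cmDatum L 2 (Matrix.of fun i j : Fin 2 => if i.val + j.val + 1 = 2 then (1 : L) else 0)).Local v ×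
      (UnitaryGroup.cmDatum L 1 (Matrix.of fun i j : Fin 1 => if i.val + j.val + 1 = 1 then (1 : L) else 0)).Local v)))]
    [∀ a : ((UnitaryGroup.cmDatum L 2 (Matrix.of fun i j : Fin 2 => if i.val + j.val + 1 = 2 then (1 : L) else 0)).Local v ×
      (UnitaryGroup.cmDatum L 1 (Matrix.of fun i j : Fin 1 => if i.val + j.val + 1 = 1 then (1 : L) else 0)).Local v),
      BorelSpace (((UnitaryGroup.cmDatum L 2 (Matrix.of fun i j : Fin 2 => if i.val + j.val + 1 = 2 then (1 : L) else 0)).Local v ×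
      (UnitaryGroup.cmDatum L 1 (Matrix.of fun i j : Fin 1 => if i.val + j.val + 1 = 1 then (1 : L) else 0)).Local v) ⧸
        Subgroup.centralizer ({a} : Set ((UnitaryGroup.cmDatum L 2 (Matrix.of fun i j : Fin 2 => if i.val + j.val + 1 = 2 then (1 : L) else 0)).Local v ×
      (UnitaryGroup.cmDatum L 1 (Matrix.of fun i j : Fin 1 => if i.val + j.val + 1 = 1 then (1 : L) else 0)).Local v)))]
    [∀ γ : ((UnitaryGroup.cmDatum L 3 H').Local v), MeasurableSpace (((UnitaryGroup.cmDatum L 3 H').Local v) ⧸ Subgroup.centralizer ({γ} : Set ((UnitaryGroup.cmDatum L 3 H').Local v)))]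
    [∀ γ : ((UnitaryGroup.cmDatum L 3 H').Local v), BorelSpace (((UnitaryGroup.cmDatum L 3 H').Local v) ⧸ Subgroup.centralizer ({γ} : Set ((UnitaryGroup.cmDatum L 3 H').Local v)))]
    (νG : Measure ((UnitaryGroup.cmDatum L 3 H').Local v)) [νG.IsHaarMeasure] [νG.IsMulRightInvariant]
    (νH : Measure ((UnitaryGroup.cmDatum L 2 (Matrix.of fun i j : Fin 2 => if i.val + j.val + 1 = 2 then (1 : L) else 0)).Local v ×
      (UnitaryGroup.cmDatum L 1 (Matrix.of fun i j : Fin 1 => if i.val + j.val + 1 = 1 then (1 : L) else 0)).Local v))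
    [νH.IsHaarMeasure] [νH.IsMulRightInvariant]
    (mH : OrbitalMeasureFamily ((UnitaryGroup.cmDatum L 2 (Matrix.of fun i j : Fin 2 => if i.val + j.val + 1 = 2 then (1 : L) else 0)).Local v ×
      (UnitaryGroup.cmDatum L 1 (Matrix.of fun i j : Fin 1 => if i.val + j.val + 1 = 1 then (1 : L) else 0)).Local v))
    (mG : OrbitalMeasureFamily ((UnitaryGroup.cmDatum L 3 H').Local v))
    (hm : mH.IsCanonical (IsLocalGRegular L v) νH ∧
      mG.IsCanonical (fun γ => IsRegularElt (γ.val : GL (Fin 3) (UnitaryGroup.LocalRing L v))) νG)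
    (hT : IsLocalDeltaTransferExists L H' v (finExplicitCollection L H' μ (finExplicitDelta_conj_left_all L H' μ) (finExplicitDelta_conj_right_all L H' μ) v) mH mG
      IsLocSmooth IsLocSmooth)
    (ρ : Finset (IrrClass ((UnitaryGroup.cmDatum L 2 (Matrix.of fun i j : Fin 2 => if i.val + j.val + 1 = 2 then (1 : L) else 0)).Local v ×
      (UnitaryGroup.cmDatum L 1 (Matrix.of fun i j : Fin 1 => if i.val + j.val + 1 = 1 then (1 : L) else 0)).Local v)))
    (hρ : Summit.HodgeConjecture.HodgeConjecture.R90.S4.IsRogPacketH L v ρ) :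
    ∃ c : IrrClass ((UnitaryGroup.cmDatum L 3 H').Local v) →₀ ℤ,
      IsEndoExpansion L H' v νG νH (finExplicitCollection L H' μ (finExplicitDelta_conj_left_all L H' μ) (finExplicitDelta_conj_right_all L H' μ) v) mH mG ρ c :=
  -- ED. 2 PAYMENT (dealer (W-A) 21:30:35Z; audit1 pre-box probe 7f0424ec7495c385 rc 0 · s0): ★ p861924 (R-ii) ∘ S4-B `stub_R90_S4_H_stable` ∘ FILE E socket 6
  endoExpansion_exists_split_of_stable_of_vanDijk L H' v hH' hH'd μ hμω hs νG νH mH mG hm ρ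
    (Summit.HodgeConjecture.HodgeConjecture.R90.S4.stub_R90_S4_H_stable L v νH mH hm.1 ρ hρ)
    (stub_R90_S3_print_4131b_vanDijkSplit L H' v hH' hH'd μ hμu hμω hs νG νH mH mG hm hT ρ hρ)

end Summit.HodgeConjecture.HodgeConjecture.R90.S3
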